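import Literature.AlgebraicTopology.CharacteristicClasses.TautologicalEulerClass
import Literature.AlgebraicTopology.CharacteristicClasses.LineThomSplitting
import Literature.AlgebraicTopology.CharacteristicClasses.ProjectiveCompletionParts
import Literature.AlgebraicTopology.SingularHomology.PuncturedCupSphere
import HarnessLib

/-!
# The Gysin surjectivity `⌣x : Hᵏ(ℙ(V)) ↠ Hᵏ⁺²(ℙ(V))` for the tautological line bundle

J. Milnor, J. Stasheff, *Characteristic Classes* (1974), §14 Thm. 14.4 and its proof via the Gysin
sequence of `γ¹ → ℂPⁿ` (Thm. 12.2: `… → Hᵏ(B) --⌣e--> Hᵏ⁺²(B) → Hᵏ⁺²(E₀) → …`, with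
`E₀(γ¹(V)) = V ∖ 0 ≃ S²ⁿ⁻¹`, so "`⌣e` is onto for `k + 2 ≠ 2n - 1`" — in particular `⌣x` maps
`H²ⁱ⁻²` ONTO `H²ⁱ` for `i ≤ n - 1`, the multiplicative input of `H*(ℂPⁿ⁻¹) = ℤ[x]/(xⁿ)`);
D. Husemoller, *Fibre Bundles* (1994), Ch. 17 §2 Thm. 2.3. In the projective-completion model of
the tree, for `V` of complex dimension `n` and `x = e(γ¹(V))` (`tautEuler`):

* `tautPunctured : E₀(γ¹(V)) ≃ₜ V ∖ 0` and `eq_zero_tautInter`: `Hʲ(E₀; R) = 0` for `j ≠ 0, 2n - 1`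
  (`V ∖ 0` is a cup-sphere of level `2n - 1`, `PuncturedCupSphere`);
* **`cup_tautEuler_surjective`**: for `k + 2 ≠ 2n - 1`, every `c ∈ Hᵏ⁺²(ℙ(V); R)` is `y ⌣ x`.
  Proof (the Gysin argument, Mayer–Vietoris form): glue `π₀^* c` on the finite part `D ∖ s_∞ ⊇ s₀`
  of `D = P(γ¹ ⊕ ℂ)` with `0` on the vector part `D ∖ s₀ ⊇ s_∞` — they agree on the overlap `≅ E₀`
  because its cohomology vanishes there — to a class `z`; by the Thom splitting
  (`LineThomSplitting`) `z = π^*a + π^*y ⌣ t`; then `a = s_∞^* z = 0` and `c = s₀^* z = y ⌣ s₀^*t = y ⌣ x`.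

Everything is proved; no named facts.

## References

* J. Milnor, J. Stasheff, *Characteristic Classes*, PUP 1974, §12 Thm. 12.2 (Gysin), §14 Thm. 14.4. [MilnorStasheff1974]
* D. Husemoller, *Fibre Bundles*, GTM 20, Springer 1994, Ch. 17 §2 Thm. 2.3, §7 Thm. 7.5. [HusemollerFibreBundles1994]
-/

noncomputable section

open CategoryTheory Function Set Bundle Module Literature.AlgebraicTopology.SingularHomology
open scoped LinearAlgebra.Projectivization

namespace Literature.AlgebraicTopology.CharacteristicClasses

variable (V : Type) [NormedAddCommGroup V] [NormedSpace ℂ V] [FiniteDimensional ℂ V] (R : Type) [CommRing R]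

/-! ### `E₀(γ¹(V)) ≅ V ∖ 0` -/

omit [FiniteDimensional ℂ V] in
/-- A nonzero vector of the line `ℓ` spans it: `[w] = ℓ`. [folklore] -/
theorem mk_eq_of_mem_submodule {ℓ : ℙ ℂ V} {w : V} (hw : w ∈ Projectivization.submodule ℓ) (hw0 : w ≠ 0) :
    Projectivization.mk ℂ w hw0 = ℓ := by
  induction ℓ using Projectivization.ind with
  | h u hu =>
    rw [Projectivization.submodule_mk] at hw
    obtain ⟨c, rfl⟩ := Submodule.mem_span_singleton.1 hw
    have hc : c ≠ 0 := fun h ↦ hw0 (by rw [h, zero_smul])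
    exact (Projectivization.mk_eq_mk_iff ℂ _ _ (smul_ne_zero hc hu) hu).2 ⟨Units.mk0 c hc, rfl⟩

/-- **The vector map `(ℓ, w) ↦ w : E(γ¹(V)) → V` is continuous** (locally `w = φ(w) • v_φ(ℓ)`). [folklore] -/
theorem continuous_tautFiberVec : Continuous fun q : TotalSpace ℂ (tautFiber ℂ V) ↦ (q.2 : V) := by
  refine continuous_iff_continuousAt.2 fun q₀ ↦ ?_
  set χ : V →L[ℂ] ℂ := chartFunctional ℂ V q₀.proj
  set e := trivializationAt ℂ (tautFiber ℂ V) q₀.proj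
  have hq₀ : q₀.proj ∈ chartDomain ((χ : V →L[ℂ] ℂ) : Module.Dual ℂ V) := mem_chartDomain_chartFunctional ℂ V q₀.proj
  -- near `q₀`, `q.2 = (e q).2 • v_χ(q.proj)`
  have hev : ∀ᶠ q in nhds q₀, ((e q).2 • affineRep ((χ : V →L[ℂ] ℂ) : Module.Dual ℂ V) q.proj : V) = (q.2 : V) := by
    have hopen : IsOpen (TotalSpace.proj ⁻¹' chartDomain ((χ : V →L[ℂ] ℂ) : Module.Dual ℂ V) : Set (TotalSpace ℂ (tautFiber ℂ V))) :=
      (isOpen_chartDomain _ χ.continuous).preimage (continuous_tautProj ℂ V)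
    filter_upwards [hopen.mem_nhds hq₀] with q hq
    exact apply_smul_affineRep ((χ : V →L[ℂ] ℂ) : Module.Dual ℂ V) hq q.2
  refine ContinuousAt.congr ?_ hev
  have he : ContinuousAt e q₀ := e.continuousAt (e.mem_source.2 (mem_baseSet_trivializationAt ℂ (tautFiber ℂ V) q₀.proj))
  have haff : ContinuousAt (fun q : TotalSpace ℂ (tautFiber ℂ V) ↦ affineRep ((χ : V →L[ℂ] ℂ) : Module.Dual ℂ V) q.proj) q₀ :=
    ((continuousOn_affineRep _ χ.continuous).continuousAt ((isOpen_chartDomain _ χ.continuous).mem_nhds hq₀)).comp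
      (continuous_tautProj ℂ V).continuousAt
  exact (continuousAt_snd.comp he).smul haff

/-- The point `(⟨v⟩, v)` of `E(γ¹(V))` over the line through `v ≠ 0`. [folklore] -/
def tautLinePt (v : {v : V // v ≠ 0}) : TotalSpace ℂ (tautFiber ℂ V) :=
  ⟨Projectivization.mk ℂ v.1 v.2, ⟨v.1, by rw [Projectivization.submodule_mk]; exact Submodule.mem_span_singleton_self _⟩⟩

/-- `v ↦ (⟨v⟩, v)` is continuous (checked in the canonical chart at `⟨v⟩`). [folklore] -/
theorem continuous_tautLinePt : Continuous (tautLinePt V) := by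
  refine continuous_iff_continuousAt.2 fun v₀ ↦ ?_
  set e := trivializationAt ℂ (tautFiber ℂ V) (tautLinePt V v₀).proj
  refine e.continuousAt_of_comp_left ?_ (mem_baseSet_trivializationAt ℂ (tautFiber ℂ V) _) ?_
  · exact ((continuous_subtype_val.projectivizationMk (K := ℂ) fun v : {v : V // v ≠ 0} ↦ v.2).continuousAt :)
  · change ContinuousAt (fun v : {v : V // v ≠ 0} ↦ (Projectivization.mk ℂ v.1 v.2,
      chartFunctional ℂ V (tautLinePt V v₀).proj v.1)) v₀
    exact ((continuous_subtype_val.projectivizationMk (K := ℂ) fun v : {v : V // v ≠ 0} ↦ v.2).prodMk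
      ((chartFunctional ℂ V (tautLinePt V v₀).proj).continuous.comp continuous_subtype_val)).continuousAt

/-- **`E₀(γ¹(V)) ≃ₜ V ∖ 0`**, `(ℓ, w) ↦ w` (Milnor–Stasheff §14: the nonzero vectors of the
canonical line bundle form `ℂⁿ ∖ 0`). [cite: MilnorStasheff1974, §14 proof of Thm. 14.4] -/
def tautPunctured : {q : TotalSpace ℂ (tautFiber ℂ V) // q.2 ≠ 0} ≃ₜ {v : V // v ≠ 0} where
  toFun q := ⟨(q.1.2 : V), fun h ↦ q.2 (Subtype.ext h)⟩
  invFun v := ⟨tautLinePt V v, fun h ↦ v.2 (congrArg Subtype.val h)⟩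
  left_inv q := by
    obtain ⟨⟨ℓ, w⟩, hw⟩ := q
    have hw0 : (w : V) ≠ 0 := fun h ↦ hw (Subtype.ext h)
    apply Subtype.ext
    change (⟨Projectivization.mk ℂ (w : V) hw0, ⟨(w : V), _⟩⟩ : TotalSpace ℂ (tautFiber ℂ V)) = ⟨ℓ, w⟩
    have key : ∀ (ℓ' : ℙ ℂ V) (_ : ℓ' = ℓ) (hmem : (w : V) ∈ Projectivization.submodule ℓ'),
        (⟨ℓ', ⟨(w : V), hmem⟩⟩ : TotalSpace ℂ (tautFiber ℂ V)) = ⟨ℓ, w⟩ := by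
      rintro _ rfl _; rfl
    exact key _ (mk_eq_of_mem_submodule V w.2 hw0) _
  right_inv _ := rfl
  continuous_toFun := ((continuous_tautFiberVec V).comp continuous_subtype_val).subtype_mk _
  continuous_invFun := ((continuous_tautLinePt V).comp continuous_id).subtype_mk _

/-- **`Hʲ(E₀(γ¹(V)); R) = 0` for `j ≠ 0, 2n - 1`** (`n = dim V ≥ 1`; `E₀ ≅ V ∖ 0 ≃ S²ⁿ⁻¹`), read on
the overlap of the two parts of `P(γ¹ ⊕ ℂ)`. [cite: MilnorStasheff1974, §14 proof of Thm. 14.4] -/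
theorem eq_zero_tautInter {n : ℕ} (hn : finrank ℂ V = n) (hn1 : 1 ≤ n) {j : ℕ} (hj0 : j ≠ 0) (hj : j ≠ 2 * n - 1)
    (x : singularCohomology R R ↥(finitePart ℂ (tautFiber ℂ V) ∩ vectorPart ℂ (tautFiber ℂ V)) j) : x = 0 := by
  obtain ⟨g, hg⟩ := exists_isCupSphere_ne_zero R V (N := 2 * n - 1) (by rw [finrank_real_of_complex, hn]; omega)
  let e : ↥(finitePart ℂ (tautFiber ℂ V) ∩ vectorPart ℂ (tautFiber ℂ V)) ≃ₜ {v : V // v ≠ 0} :=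
    (puncturedHomeomorph ℂ (tautFiber ℂ V)).symm.trans (tautPunctured V)
  apply (singularCohomology.mapIso R R e.symm j).toLinearEquiv.injective
  rw [map_zero]
  exact hg.eq_zero_of_ne hj0 hj _

/-! ### The Gysin surjectivity -/

/-- The section at infinity, corestricted to the vector part. [folklore] -/
def complInfPart : C(ℙ ℂ V, ↥(vectorPart ℂ (tautFiber ℂ V))) :=
  ⟨fun b ↦ ⟨complInf ℂ (tautFiber ℂ V) (Module.finrank_self ℂ) b, complInf_mem_vectorPart _ _ (Module.finrank_self ℂ) b⟩,
    (complInf ℂ (tautFiber ℂ V) (Module.finrank_self ℂ)).continuous.subtype_mk _⟩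

/-- The zero section, corestricted to the finite part. [folklore] -/
def complZeroPart : C(ℙ ℂ V, ↥(finitePart ℂ (tautFiber ℂ V))) :=
  ⟨fun b ↦ ⟨complZero ℂ (tautFiber ℂ V) b, complZero_mem_finitePart _ _ b⟩, (complZero ℂ (tautFiber ℂ V)).continuous.subtype_mk _⟩

/-- **Gysin surjectivity for `γ¹(V) → ℙ(V)`**: for `k + 2 ≠ 2n - 1` (`n = dim_ℂ V ≥ 1`), every class
of `Hᵏ⁺²(ℙ(V); R)` is `y ⌣ x` with `x = e(γ¹(V))` (Milnor–Stasheff Thm. 12.2 / proof of Thm. 14.4).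
[cite: MilnorStasheff1974, §12 Thm. 12.2, §14 Thm. 14.4] -/
theorem cup_tautEuler_surjective {n : ℕ} (hn : finrank ℂ V = n) (hn1 : 1 ≤ n) {k : ℕ} (hk : k + 2 ≠ 2 * n - 1) :
    Surjective fun y : singularCohomology R R (ℙ ℂ V) k ↦ cupProduct (show k + 2 = k + 2 from rfl) y (tautEuler V R 1) := by
  intro c
  -- notation
  have hℂ : Module.finrank ℂ ℂ = 1 := Module.finrank_self ℂ
  let D := ProjCompl ℂ (tautFiber ℂ V)
  let V₀ : Set D := finitePart ℂ (tautFiber ℂ V)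
  let V₁ : Set D := vectorPart ℂ (tautFiber ℂ V)
  let t : singularCohomology R R D 2 := thomClass ℂ (tautFiber ℂ V) hℂ R 1
  have ht : IsThomClass ℂ (tautFiber ℂ V) hℂ R 1 t := isThomClass_thomClass ℂ (tautFiber ℂ V) hℂ R 1
  let π₀ : C(↥V₀, ℙ ℂ V) := (complProj ℂ (tautFiber ℂ V)).comp (subsetIncl V₀)
  -- (1) glue `π₀^* c` (finite part) and `0` (vector part)
  obtain ⟨z, hz₀, hz₁⟩ := singularCohomology.exists_of_map_inclusion_eq R (isOpen_finitePart ℂ (tautFiber ℂ V))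
    (isOpen_vectorPart ℂ (tautFiber ℂ V)) (finitePart_union_vectorPart ℂ (tautFiber ℂ V))
    (singularCohomology.map R R π₀ (k + 2) c) 0
    (by rw [map_zero]; exact eq_zero_tautInter V R hn hn1 (by omega) hk _)
  -- (2) the Thom splitting of `z`
  obtain ⟨⟨x, y⟩, hxy⟩ := (ht.thomSplit_bijective k).2 z
  change singularCohomology.map R R (complProj ℂ (tautFiber ℂ V)) (k + 2) x +
    cupProduct (show k + 2 = k + 2 from rfl) (singularCohomology.map R R (complProj ℂ (tautFiber ℂ V)) k y) t = z at hxy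
  -- (3) `x = s_∞^* z = 0`
  have hx : x = 0 := by
    have h1 : singularCohomology.map R R (complInf ℂ (tautFiber ℂ V) hℂ) (k + 2) z = 0 := by
      have hc : complInf ℂ (tautFiber ℂ V) hℂ = (subsetIncl V₁).comp (complInfPart V) := rfl
      rw [hc, singularCohomology.map_comp, ModuleCat.comp_apply, hz₁, map_zero]
    rw [← hxy, map_add, cupProduct_map, ht.map_complInf, LinearMap.map_zero, add_zero, ← ModuleCat.comp_apply,
      ← singularCohomology.map_comp, complProj_comp_complInf, singularCohomology.map_id] at h1
    exact h1
  -- (4) `c = s₀^* z = y ⌣ x`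
  have h2 : singularCohomology.map R R (complZero ℂ (tautFiber ℂ V)) (k + 2) z = c := by
    have hc : complZero ℂ (tautFiber ℂ V) = (subsetIncl V₀).comp (complZeroPart V) := rfl
    rw [hc, singularCohomology.map_comp, ModuleCat.comp_apply, hz₀, ← ModuleCat.comp_apply, ← singularCohomology.map_comp]
    have hid : π₀.comp (complZeroPart V) = ContinuousMap.id _ := rfl
    rw [hid, singularCohomology.map_id]
    rfl
  refine ⟨y, ?_⟩
  change cupProduct (show k + 2 = k + 2 from rfl) y (tautEuler V R 1) = c
  rw [← h2, ← hxy, map_add, cupProduct_map, hx, map_zero, map_zero, zero_add, ← ModuleCat.comp_apply,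
    ← singularCohomology.map_comp, complProj_comp_complZero, singularCohomology.map_id]
  rfl

end Literature.AlgebraicTopology.CharacteristicClasses
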